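import Mathlib

/-!
# Skew-cut certificate: limits of Galerkin eigenpairs are eigenpairs (the compactness step of
Theorem 2 (ii) of `selfsim/SKEWCUT-CERT.md`, abstract Hilbert-space form)
(instab4 g3 — implementation 2 of the skew-cut X0 certifier, cell `ns-blowup`, 2026-08-26)

HONEST FRAMING (human ruling D-0035): nothing here is a claim about Navier–Stokes blow-up.
WHAT THIS IS NOT: not NS evidence. Companion of `SkewCutCertificate.lean` (selfsim g3: the finite
cores of Theorems 1/1′/2) and `SkewCutAPosteriori.lean` / `TwoSidedResidualEnclosure.lean` (the
certifier algebra). The certificate proves, for the MODEL operator `L` «NS linearised about the forced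
ABC flow» compressed to a symmetry class, that EVERY Galerkin section `L_n = P_n L P_n`, `n ≥ K`, has a
real eigenvalue `x_n` in a bracket `(x₁, x₂)` (kernel: `SkewCutCertificate.exists_eigenvalue_of_det_sign_change`
after sign transport). Theorem 2 (ii) of the method note then passes to the infinite-dimensional operator:
«ENERGY + H²-BOUND (uniform graph-norm bound of the normalised Galerkin eigenvectors), COMPACTNESS
(Rellich), LIMIT EQUATION». This file makes the last two steps kernel in abstract form, with the
unbounded `L` presented through a compact resolvent `S = (x₀ − L)⁻¹` (so `D(L) = range S` and
`L (S w) = x₀ S w − w`):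

* `galerkin_eigenpair_limit` — let `S` be a compact operator on a Hilbert space, `P_n` self-adjoint
  bounded operators converging strongly to `1`, `w_n` a bounded sequence with `‖S w_n‖ = 1`
  (`v_n := S w_n` are the normalised Galerkin eigenvectors, `w_n = (x₀ − L) v_n` their graph-norm
  data), `x_n → λ`, and the GALERKIN EIGEN-RELATION `P_n w_n = (x₀ − x_n) • v_n` (which is
  `P_n (x_n − L) v_n = 0` for `v_n ∈ range P_n`). Then a subsequence of `v_n` converges to some `v`
  with `‖v‖ = 1` and `(x₀ − λ) • S v = v`, i.e. `v = S u ∈ D(L)` with `u = (x₀ − λ) v` and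
  `L v = x₀ v − u = λ v`: `(λ, v)` is an eigenpair of `L` (`eigen_of_resolvent_fixed`).
  Only ONE compactness extraction is used; the defect term `S (1 − P_n) w_n` is killed by testing
  against the candidate limit (`⟪S (1 − P_n) w_n, z⟫ = ⟪w_n, (1 − P_n) S† z⟫ → 0`), so neither
  `‖P_n‖ ≤ c`, nor idempotency, nor compactness of `S†` is needed.
* `galerkin_eigenpair_limit_Icc` — the bracket form over `ℝ`: if every `x_n ∈ [a, b]` then the limit
  eigenvalue `λ ∈ [a, b]` exists without assuming convergence of `x_n` (compactness of `[a, b]`), and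
  `λ ∈ (a, b)` as soon as `a` and `b` are not eigenvalues (in the certificate: Theorem 1 (a) at the two
  bracket ends, `x_i − L` injective).

What stays model-specific (paper-grade in the note, §4 (ii)): the uniform bound `‖(x₀ − L) v_n‖ ≤ C`
(ENERGY and H²-BOUND lines), compactness of the resolvent of the class-II compression of `L` on `H`,
injectivity of `x_i − L` (Theorem 1 (a)), and elliptic regularity `H² → C^∞` to reach
`Literature.Analysis.FluidPDE.Torus.IsLinNSEigenvalue`.

Mathlib only; no new definitions. (Shelf: `Literature.Analysis.Calculus.GalerkinCompactConvergence`,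
Krasnosel'skii et al. 1972 §15.5 — the companion statement `‖(1 − P_n) T‖ → 0` for compact `T`; not
needed here because the defect is only ever tested against one fixed vector.)
-/

namespace Summit.NavierStokesRegularity.FluidComputer.SkewCutGalerkinLimit

open Filter Topology
open scoped InnerProductSpace

variable {𝕜 E : Type*} [RCLike 𝕜] [NormedAddCommGroup E] [InnerProductSpace 𝕜 E] [CompleteSpace E]

/-- The defect term tested against a fixed vector: if `P_n → 1` strongly, each `P_n` is self-adjoint
and `‖w_n‖ ≤ C`, then `⟪S ((1 − P_n) w_n), z⟫ → 0` for every bounded `S` and every `z`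
(`= ⟪w_n, (1 − P_n) (S† z)⟫`, and `(1 − P_n)(S† z) → 0` in norm). -/
theorem inner_defect_tendsto_zero (S : E →L[𝕜] E) (P : ℕ → E →L[𝕜] E)
    (hPsa : ∀ n, IsSelfAdjoint (P n)) (hPs : ∀ x : E, Tendsto (fun n => P n x) atTop (𝓝 x))
    (w : ℕ → E) {C : ℝ} (hw : ∀ n, ‖w n‖ ≤ C) (z : E) :
    Tendsto (fun n => ⟪S ((1 - P n) (w n)), z⟫_𝕜) atTop (𝓝 0) := by
  have hC : 0 ≤ C := (norm_nonneg _).trans (hw 0)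
  -- move everything onto the fixed vector `S† z`
  have key : ∀ n, ⟪S ((1 - P n) (w n)), z⟫_𝕜 = ⟪w n, (1 - P n) (ContinuousLinearMap.adjoint S z)⟫_𝕜 := by
    intro n
    have h1 : IsSelfAdjoint (1 - P n) := (IsSelfAdjoint.one _).sub (hPsa n)
    rw [← ContinuousLinearMap.adjoint_inner_right S, ← ContinuousLinearMap.adjoint_inner_left (1 - P n),
      h1.adjoint_eq]
  simp_rw [key]
  -- `(1 - P n) y → 0` for the fixed `y = S† z`
  set y := ContinuousLinearMap.adjoint S z with hy
  have hy0 : Tendsto (fun n => (1 - P n) y) atTop (𝓝 0) := by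
    have : Tendsto (fun n => y - P n y) atTop (𝓝 (y - y)) := tendsto_const_nhds.sub (hPs y)
    simpa using this
  rw [tendsto_zero_iff_norm_tendsto_zero]
  have hbound : ∀ n, ‖⟪w n, (1 - P n) y⟫_𝕜‖ ≤ C * ‖(1 - P n) y‖ := fun n =>
    (norm_inner_le_norm _ _).trans (mul_le_mul_of_nonneg_right (hw n) (norm_nonneg _))
  refine squeeze_zero (fun n => norm_nonneg _) hbound ?_
  have := (tendsto_zero_iff_norm_tendsto_zero.mp hy0).const_mul C
  simpa using this

/-- **Limits of Galerkin eigenpairs are eigenpairs (Theorem 2 (ii), compactness + limit equation,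
abstract form).** `S` compact (the resolvent `(x₀ − L)⁻¹`), `P_n` self-adjoint with `P_n → 1`
strongly, `w_n` bounded with `‖S w_n‖ = 1`, `x_n → λ`, and the Galerkin eigen-relation
`P_n w_n = (x₀ − x_n) • S w_n`. Then some subsequence of `v_n = S w_n` converges to a `v` with
`‖v‖ = 1` and `(x₀ − λ) • S v = v`. -/
theorem galerkin_eigenpair_limit (S : E →L[𝕜] E) (hS : IsCompactOperator S)
    (P : ℕ → E →L[𝕜] E) (hPsa : ∀ n, IsSelfAdjoint (P n))
    (hPs : ∀ x : E, Tendsto (fun n => P n x) atTop (𝓝 x))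
    (w : ℕ → E) {C : ℝ} (hw : ∀ n, ‖w n‖ ≤ C) (hv1 : ∀ n, ‖S (w n)‖ = 1)
    (x₀ : 𝕜) (xs : ℕ → 𝕜) {lam : 𝕜} (hxs : Tendsto xs atTop (𝓝 lam))
    (hGal : ∀ n, P n (w n) = (x₀ - xs n) • S (w n)) :
    ∃ v : E, ‖v‖ = 1 ∧ (x₀ - lam) • S v = v ∧
      ∃ φ : ℕ → ℕ, StrictMono φ ∧ Tendsto (fun k => S (w (φ k))) atTop (𝓝 v) := by
  -- compactness: `v_n = S w_n` lies in a fixed compact set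
  obtain ⟨K, hK, hSK⟩ := hS.image_closedBall_subset_compact (f := (S : E →ₗ[𝕜] E)) C
  have hmem : ∀ n, S (w n) ∈ K := fun n =>
    hSK ⟨w n, by simpa using hw n, rfl⟩
  obtain ⟨v, -, φ, hφ, hφv⟩ := hK.tendsto_subseq (x := fun n => S (w n)) hmem
  refine ⟨v, ?_, ?_, φ, hφ, hφv⟩
  · -- `‖v‖ = 1`
    have h1 : Tendsto (fun k => ‖S (w (φ k))‖) atTop (𝓝 ‖v‖) := hφv.norm
    have h2 : Tendsto (fun k => ‖S (w (φ k))‖) atTop (𝓝 1) := by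
      simp_rw [hv1]; exact tendsto_const_nhds
    exact tendsto_nhds_unique h1 h2
  · -- the limit equation: `z := v − (x₀ − λ) S v` is the limit of the defects `S (1 − P) w`
    set z : E := v - (x₀ - lam) • S v with hz
    have hdef : ∀ n, S ((1 - P n) (w n)) = S (w n) - (x₀ - xs n) • S (S (w n)) := by
      intro n
      have e : (1 - P n) (w n) = w n - P n (w n) := by simp
      rw [e, map_sub, hGal, map_smul]
    -- along the subsequence the defects converge to `z`
    have hxs' : Tendsto (fun k => xs (φ k)) atTop (𝓝 lam) := hxs.comp hφ.tendsto_atTop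
    have hlim : Tendsto (fun k => S ((1 - P (φ k)) (w (φ k)))) atTop (𝓝 z) := by
      simp_rw [hdef]
      have hSv : Tendsto (fun k => S (S (w (φ k)))) atTop (𝓝 (S v)) := (S.continuous.tendsto v).comp hφv
      have hsc : Tendsto (fun k => (x₀ - xs (φ k))) atTop (𝓝 (x₀ - lam)) := tendsto_const_nhds.sub hxs'
      exact hφv.sub (hsc.smul hSv)
    -- tested against `z` they tend to `0` (defect lemma along the subsequence) and to `‖z‖²`
    have hPs' : ∀ x : E, Tendsto (fun k => P (φ k) x) atTop (𝓝 x) := fun x =>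
      (hPs x).comp hφ.tendsto_atTop
    have h0 : Tendsto (fun k => ⟪S ((1 - P (φ k)) (w (φ k))), z⟫_𝕜) atTop (𝓝 0) :=
      inner_defect_tendsto_zero S (fun k => P (φ k)) (fun k => hPsa (φ k)) hPs' (fun k => w (φ k))
        (fun k => hw (φ k)) z
    have h1 : Tendsto (fun k => ⟪S ((1 - P (φ k)) (w (φ k))), z⟫_𝕜) atTop (𝓝 ⟪z, z⟫_𝕜) :=
      hlim.inner tendsto_const_nhds
    have hzz : ⟪z, z⟫_𝕜 = 0 := tendsto_nhds_unique h1 h0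
    have hz0 : z = 0 := inner_self_eq_zero.mp hzz
    -- unfold `z = 0`
    have : v - (x₀ - lam) • S v = 0 := by rw [← hz]; exact hz0
    exact (sub_eq_zero.mp this).symm

omit [CompleteSpace E] in
/-- **Reading the fixed-point relation as an eigen-equation.** If `(x₀ − λ) • S v = v` then
`v = S u` with `u := (x₀ − λ) • v`, and `x₀ • S u − u = λ • S u` — i.e. for `L` defined on
`range S` by `L (S u) = x₀ • S u − u` (so that `S = (x₀ − L)⁻¹`), `v ∈ D(L)` and `L v = λ v`. -/
theorem eigen_of_resolvent_fixed (S : E →L[𝕜] E) {x₀ lam : 𝕜} {v : E}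
    (h : (x₀ - lam) • S v = v) :
    S ((x₀ - lam) • v) = v ∧ x₀ • S ((x₀ - lam) • v) - (x₀ - lam) • v = lam • S ((x₀ - lam) • v) := by
  have h1 : S ((x₀ - lam) • v) = v := by rw [map_smul, h]
  refine ⟨h1, ?_⟩
  rw [h1, sub_smul, sub_sub_cancel]

/-- **Bracket form over `ℝ` (Theorem 2 (ii) as used by the certificate).** Real Hilbert space; the
Galerkin eigenvalues `x_n` all lie in `[a, b]` (Theorem 2 (i): every section has one in the bracket).
Then `L` has an eigenvalue `λ ∈ [a, b]` with a unit eigenvector (`(x₀ − λ) • S v = v`); and if the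
bracket ends are not eigenvalues (`x_i − L` injective, Theorem 1 (a)), `λ ∈ (a, b)`. -/
theorem galerkin_eigenpair_limit_Icc {F : Type*} [NormedAddCommGroup F] [InnerProductSpace ℝ F]
    [CompleteSpace F] (S : F →L[ℝ] F) (hS : IsCompactOperator S)
    (P : ℕ → F →L[ℝ] F) (hPsa : ∀ n, IsSelfAdjoint (P n))
    (hPs : ∀ x : F, Tendsto (fun n => P n x) atTop (𝓝 x))
    (w : ℕ → F) {C : ℝ} (hw : ∀ n, ‖w n‖ ≤ C) (hv1 : ∀ n, ‖S (w n)‖ = 1)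
    (x₀ : ℝ) (xs : ℕ → ℝ) {a b : ℝ} (hxs : ∀ n, xs n ∈ Set.Icc a b)
    (hGal : ∀ n, P n (w n) = (x₀ - xs n) • S (w n)) :
    ∃ lam ∈ Set.Icc a b, ∃ v : F, ‖v‖ = 1 ∧ (x₀ - lam) • S v = v ∧
      ((∀ u : F, (x₀ - a) • S u = u → u = 0) → (∀ u : F, (x₀ - b) • S u = u → u = 0) →
        lam ∈ Set.Ioo a b) := by
  -- a convergent subsequence of the eigenvalues
  obtain ⟨lam, hlam, ψ, hψ, hψlam⟩ := isCompact_Icc.tendsto_subseq hxs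
  -- the main lemma along that subsequence
  obtain ⟨v, hv1', hfix, -⟩ := galerkin_eigenpair_limit (𝕜 := ℝ) S hS (fun k => P (ψ k))
    (fun k => hPsa (ψ k)) (fun x => (hPs x).comp hψ.tendsto_atTop) (fun k => w (ψ k))
    (fun k => hw (ψ k)) (fun k => hv1 (ψ k)) x₀ (fun k => xs (ψ k)) hψlam (fun k => hGal (ψ k))
  refine ⟨lam, hlam, v, hv1', hfix, fun ha hb => ?_⟩
  have hv0 : v ≠ 0 := by
    intro h; rw [h, norm_zero] at hv1'; exact zero_ne_one hv1'
  refine ⟨lt_of_le_of_ne hlam.1 ?_, lt_of_le_of_ne hlam.2 ?_⟩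
  · rintro rfl; exact hv0 (ha v hfix)
  · rintro rfl; exact hv0 (hb v hfix)

/-- **Bracket form with REAL brackets in a Hilbert space over `𝕜 = ℝ` or `ℂ`** (the note's primary
setting is the complex space of class-II `L²` fields with real Galerkin eigenvalues `x_n ∈ [a, b]` and a
real base point `x₀`): the same conclusion as `galerkin_eigenpair_limit_Icc`, the scalars entering
through the coercion `ℝ → 𝕜`. (instab4 g3 append) -/
theorem galerkin_eigenpair_limit_Icc_ofReal (S : E →L[𝕜] E) (hS : IsCompactOperator S)
    (P : ℕ → E →L[𝕜] E) (hPsa : ∀ n, IsSelfAdjoint (P n))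
    (hPs : ∀ x : E, Tendsto (fun n => P n x) atTop (𝓝 x))
    (w : ℕ → E) {C : ℝ} (hw : ∀ n, ‖w n‖ ≤ C) (hv1 : ∀ n, ‖S (w n)‖ = 1)
    (x₀ : ℝ) (xs : ℕ → ℝ) {a b : ℝ} (hxs : ∀ n, xs n ∈ Set.Icc a b)
    (hGal : ∀ n, P n (w n) = ((x₀ : 𝕜) - (xs n : 𝕜)) • S (w n)) :
    ∃ lam ∈ Set.Icc a b, ∃ v : E, ‖v‖ = 1 ∧ ((x₀ : 𝕜) - (lam : 𝕜)) • S v = v ∧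
      ((∀ u : E, ((x₀ : 𝕜) - (a : 𝕜)) • S u = u → u = 0) →
        (∀ u : E, ((x₀ : 𝕜) - (b : 𝕜)) • S u = u → u = 0) → lam ∈ Set.Ioo a b) := by
  -- a convergent subsequence of the (real) eigenvalues, pushed into `𝕜`
  obtain ⟨lam, hlam, ψ, hψ, hψlam⟩ := isCompact_Icc.tendsto_subseq hxs
  have hψlam' : Tendsto (fun k => ((xs (ψ k) : ℝ) : 𝕜)) atTop (𝓝 ((lam : ℝ) : 𝕜)) :=
    (RCLike.continuous_ofReal.tendsto lam).comp hψlam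
  obtain ⟨v, hv1', hfix, -⟩ := galerkin_eigenpair_limit S hS (fun k => P (ψ k))
    (fun k => hPsa (ψ k)) (fun x => (hPs x).comp hψ.tendsto_atTop) (fun k => w (ψ k))
    (fun k => hw (ψ k)) (fun k => hv1 (ψ k)) (x₀ : 𝕜) (fun k => ((xs (ψ k) : ℝ) : 𝕜)) hψlam'
    (fun k => hGal (ψ k))
  refine ⟨lam, hlam, v, hv1', hfix, fun ha hb => ?_⟩
  have hv0 : v ≠ 0 := by
    intro h; rw [h, norm_zero] at hv1'; exact zero_ne_one hv1'
  refine ⟨lt_of_le_of_ne hlam.1 ?_, lt_of_le_of_ne hlam.2 ?_⟩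
  · rintro rfl; exact hv0 (ha v hfix)
  · rintro rfl; exact hv0 (hb v hfix)

end Summit.NavierStokesRegularity.FluidComputer.SkewCutGalerkinLimit
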